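import Literature.MathematicalPhysics.QuantumFieldTheory.Balaban1983to89.B4ThmAlphaUniform
import Literature.MathematicalPhysics.QuantumFieldTheory.Balaban1983to89.B4ThmTorusJoinFam

/-!
# `Balaban1983to89.B4ThmAlphaUniformBox` — [Balaban1983RegularityDecay] THEOREM p. 573, (1.9)–(1.12), IN THE PRINT'S
# QUANTIFIER ORDER («δ₀, c₀, R₀ … depending on d, M only, c₀ on α also») ON THE PARALLELEPIPED FAMILIES — lattice box
# pairs (r04∕p17), torus parallelepipeds (dag-p3 g3) — AND ON THE JOINS OF ALL FOUR (1.7)-REGULAR η-FAMILIES OF THE TREE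

statement-level skeleton of published theorems with citation tags; proofs where landed; nothing here is a claim about the Yang–Mills mass gap

CITATION HEADER.  T. Bałaban, *Regularity and decay of lattice Green's functions*, Commun. Math. Phys. **89** (1983)
571–597, doi:10.1007/bf01214744 [Balaban1983RegularityDecay] (cell paper B4; held text
`paper:balaban1983-cmp89-regularity-decay`, journal page = PDF page + 570; p. 573 [PDF 3] Theorem (1.9)–(1.12), p. 572
[PDF 2] (1.7), «operators on subsets of a torus T_η»).  Seat `pub-ymgap-dag-p3` gen 4 (Track A, YM-PLAN §2 node N01 =
[B4]; HOME `run/shared/lean/pub/pub-ymgap/`) — companion of `B4ThmAlphaUniform` (the print's order `∃ (δ₀, R₀) ∀ α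
∃ (c₀, e₁)` on the lattice region-pair and torus region-pair families): the same re-ordering on the two PARALLELEPIPED
families, so that every candidate `famE` of the tree (and their joins) carries the `α`-uniform reading.  Imports:
`B4ThmAlphaUniform` (`ThmPrintedNNUnif`, `thmPrintedNNUnif_sumElim`, the region ∕ torus instances), dag-p3 g4
`B4ThmTorusJoinFam` (`torusBoxFam_signs`; → dag-p3 g3 `B4ThmTorusBox`: `torusBoxFam`, the packaging lemmas
`ineq19_110_torusBoxFam` ∕ `ineq111_112_torusBoxFam`; → r04 `B4ThmBoxPairEtaNoCollar`: `box_pair_members_noCollar`,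
`boxPairFamNC`, `KmodNC`; → dag-p3 g2 `B4ThmJoinFam`: sign lemmas).

WHAT IS PRINTED.  p. 573 [PDF 3], verbatim: «Theorem (Proposition 2.1 of [1]). For α < 1 there exist positive
constants δ₀, c₀, R₀ independent of A, k, Ω and depending on d, M only, c₀ on α also, such that for e sufficiently small
and for an arbitrary function f : Ω → R^N, we have [(1.9)–(1.12)] … For some simple sets Ω, e.g. for rectangular
parallelepipeds, the inequalities hold without any restrictions on the points x, x′, i.e. for all x, x′ ∈ Ω.»

WHY NOTHING NEW IS NEEDED.  r04's `box_pair_members_noCollar` is `∃ K ≥ 16, 4 ∣ K, ∀ α ∈ [0,1), ∃ C, ∀ (c, β), ∃ e₁, …`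
with the rate `e^{−dist/K}` (resp. `e^{−(·)/(2K)}`) `α`-free, and `thmPrintedNN_boxPairFamNC` sets `δ₀ := (2K)⁻¹`,
`R₀ := 1` (idle: `rect := True`); dag-p3 g3's `thmPrintedNN_torusBoxFam` combines the torus and box quadruples per `α`
through constants `dHalf δ_T δ_B = min/2`, `cAll`, `R_T` whose `δ`- and `R`-parts depend on `(δ_T, δ_B, R_T)` only.
With `B4ThmAlphaUniform`'s uniform torus quadruple and §1 below, both assemblies run in the print's order verbatim.

WHAT THIS MODULE PROVES (kernel, sorry-free, theorems only).
* §1 **`thmPrintedNNUnif_boxPairFamNC : ThmPrintedNNUnif (boxPairFamNC F d ℓ a₋ a₊ m²₊ c β (KmodNC …))`** — r04's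
  assembly with `δ₀ = (2K)⁻¹`, `R₀ = 1` fixed before `α` (lattice parallelepiped pairs `Ω ⊂ Ω₀ ⊂ ηℤ^{d+1}`, no
  restriction on the points, collar-free (1.7) on `Ω₀`).
* §2 **`thmPrintedNNUnif_torusBoxFam : ThmPrintedNNUnif (torusBoxFam F d ℓ a₋ a₊ m²₊ c β (Kmod …) (KmodNC …))`** —
  dag-p3 g3's assembly in the same order (proper parallelepipeds `Ω ⊂ Ω₀ = T_η`, no restriction on the points;
  `δ₀ = min(δ_T, δ_B)/2`, `R₀ = R_T` before `α`, `c₀ = cAll(c_T(α), c_B(α), δ_T, δ_B, R_T)`, `e₁ = min` after).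
* §3 the joins in the uniform form: `thmPrintedNNUnif_latticeJoin` ((L) ⊕ (B)), `thmPrintedNNUnif_join3`
  (((L) ⊕ (B)) ⊕ (T)), `thmPrintedNNUnif_torusJoin` ((T) ⊕ (TB)), `thmPrintedNNUnif_join4` ((((L) ⊕ (B)) ⊕ (T)) ⊕ (TB))
  — one pair `(δ₀, R₀)` BEFORE `α` for every (1.7)-regular η-family of the tree at once; each implies the corresponding
  `ThmPrintedNN` join of `B4ThmJoinFam` ∕ `B4ThmTorusJoinFam` by `thmPrintedNN_of_unif`.
HONEST SCOPE.  Exactly that of the four source families (r01 g8∕g9, r04∕p17, dag-p3 g3: abelian one-parameter flow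
(1.2), component fields, staircase ∕ torus contours, running coefficient with `a ∈ [a₋, a₊]`, masses `[0, m²₊]`,
`L = ℓ+1 ≥ 2`, `d ≥ 1` for the box families, block moduli `Kmod` ∕ `KmodNC`, fine torus period `≥ 3`, `0 ≤ α < 1`); the
threshold `e₁` stays after `α` (as printed on p. 573).  No definition, no `sorry`; axioms standard.  Count-neutral for
YM-PLAN (typed 28∕28; discharged count unmoved; `famE` re-pins are NODE 00's ∕ the leads' decision); nothing here
concerns the continuum limit, ℝ⁴, OS axioms, a mass gap or the Clay problem.
-/

namespace Literature.MathematicalPhysics.QuantumFieldTheory.Balaban1983to89.B4ThmAlphaUniformBox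

open Literature.MathematicalPhysics.QuantumFieldTheory.Balaban1983to89
open Literature.MathematicalPhysics.QuantumFieldTheory.Balaban1983to89.B4 (EtaSetting Ineq19_110 Ineq111_112)
open Literature.MathematicalPhysics.QuantumFieldTheory.Balaban1983to89.B4Ineq111ZeroNestEta (ThmPrintedNN)
open Literature.MathematicalPhysics.QuantumFieldTheory.Balaban1983to89.B4Reflection242 (boxDom mem_boxDom nbrs mem_nbrs)
open Literature.MathematicalPhysics.QuantumFieldTheory.Balaban1983to89.B4GaugeCovariance
open Literature.MathematicalPhysics.QuantumFieldTheory.Balaban1983to89.B4ContourShift (supNorm supNorm_nonneg)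
open Literature.MathematicalPhysics.QuantumFieldTheory.Balaban1983to89.B4Lower18Regular (e1 baseEmb stairContour)
open Literature.MathematicalPhysics.QuantumFieldTheory.Balaban1983to89.B4Lower18RegularRegion (compField)
open Literature.MathematicalPhysics.QuantumFieldTheory.Balaban1983to89.B4Lemma21Region (siteNorm
  fld_covDeriv_mulVec_of_not_mem)
open Literature.MathematicalPhysics.QuantumFieldTheory.Balaban1983to89.B4Lemma22ReduceZero (Box opA greenA derivA)
open Literature.MathematicalPhysics.QuantumFieldTheory.Balaban1983to89.B4Lemma22Reduce231 (supN le_supN supN_nonneg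
  siteNorm_nonneg siteNorm_zero siteNorm_smul)
open Literature.MathematicalPhysics.QuantumFieldTheory.Balaban1983to89.B4Lemma22HolderBox (IsNNChain)
open Literature.MathematicalPhysics.QuantumFieldTheory.Balaban1983to89.B4SubBoxCarrier (subEmb inSub inSub_iff)
open Literature.MathematicalPhysics.QuantumFieldTheory.Balaban1983to89.B4BoxCubeGeometry (posR)
open Literature.MathematicalPhysics.QuantumFieldTheory.Balaban1983to89.B4RegionCubeCarrier (compField_add)
open Literature.MathematicalPhysics.QuantumFieldTheory.Balaban1983to89.B4Thm112BoxIdentity (extV)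
open Literature.MathematicalPhysics.QuantumFieldTheory.Balaban1983to89.B4Thm112BoxValue (exists_coord_of_le_supNorm
  siteNorm_le_sqrt_card_mul abs_apply_le_siteNorm')
open Literature.MathematicalPhysics.QuantumFieldTheory.Balaban1983to89.B4Thm112BoxDeriv (restrV restrV_apply
  derivA_restrV_apply)
open Literature.MathematicalPhysics.QuantumFieldTheory.Balaban1983to89.B4ThmBoxPairEta (BoxPairInst boxPairFam)
open Literature.MathematicalPhysics.QuantumFieldTheory.Balaban1983to89.B4ThmBoxPairEtaNoCollar
open Literature.MathematicalPhysics.QuantumFieldTheory.Balaban1983to89.B4ThmRegionPairEta (RegionPairInst regionPairFam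
  Kmod region_pair_members)
open Literature.MathematicalPhysics.QuantumFieldTheory.Balaban1983to89.B4TorusPairFam (TorusPairInst torusPairFam
  tsdist1_nonneg tcdist_nonneg tbdistS_nonneg)
open Literature.MathematicalPhysics.QuantumFieldTheory.Balaban1983to89.B4ThmTorusBox (TorusBoxInst torusBoxFam
  ineq19_110_torusBoxFam ineq111_112_torusBoxFam)
open Literature.MathematicalPhysics.QuantumFieldTheory.Balaban1983to89.B4ThmJoinFam (regionPairFam_signs
  boxPairFamNC_signs torusPairFam_signs)
open Literature.MathematicalPhysics.QuantumFieldTheory.Balaban1983to89.B4ThmTorusJoinFam (torusBoxFam_signs)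
open Literature.MathematicalPhysics.QuantumFieldTheory.Balaban1983to89.B4ThmAlphaUniform (ThmPrintedNNUnif
  thmPrintedNN_of_unif thmPrintedNNUnif_sumElim thmPrintedNNUnif_regionPairFam thmPrintedNNUnif_torusPairFam
  thmPrintedNNUnif_latticeTorusJoin)
open scoped Matrix

noncomputable section

variable {ι : Type} [Fintype ι] [DecidableEq ι]

/-! ## §1. The lattice parallelepiped family (no collar): r04's assembly with `δ₀ = (2K)⁻¹` fixed before `α` -/

/-- **THEOREM p. 573 IN THE PRINT'S QUANTIFIER ORDER ON THE FAMILY OF NESTED PAIRS OF BOXES AT A (1.7)-REGULAR FIELD,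
NO COLLAR** (`boxPairFamNC`, modulus `K = KmodNC`, `rect := True`): there are `δ₀ = (2K)⁻¹ > 0` and `R₀ = 1` (idle) —
chosen before `α` — such that for every `0 ≤ α < 1` there are `c₀, e₁ > 0` with (1.9)–(1.10) for `G_k(Ω,A|Ω)` and
(1.9)–(1.10)×(1.12) for `δG_k(Ω,Ω₀,A)` at ALL points `x, x′ ∈ Ω`, for every instance whose field is (1.7)-regular on `Ω₀`,
whose boxes have unit sides multiples of `K` and whose coupling is `0 < e ≤ e₁`.  Proof = r04's
`thmPrintedNN_boxPairFamNC` with the constants fixed before `α`. [cite: Balaban1983RegularityDecay, Theorem (1.9)–(1.12) p.573 «depending on d, M only, c₀ on α also» and «for rectangular parallelepipeds … without any restrictions on the points x, x′»] -/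
theorem thmPrintedNNUnif_boxPairFamNC (F : OrthFlow ι) {ℓ₁ : ℝ} (hℓ₁ : 0 ≤ ℓ₁)
    (hLip : ∀ t (v : ι → ℝ), ((F.U t - 1) *ᵥ v) ⬝ᵥ ((F.U t - 1) *ᵥ v) ≤ (ℓ₁ * t) ^ 2 * (v ⬝ᵥ v))
    (d ℓ : ℕ) (hd : 1 ≤ d) (hℓ : 1 ≤ ℓ) (amin aplus m2plus : ℝ) (ha : 0 < amin) (creg β : ℝ) (hcreg : 0 ≤ creg)
    (hβ : 0 < β) :
    ThmPrintedNNUnif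
      (boxPairFamNC F d ℓ amin aplus m2plus creg β (KmodNC F hℓ₁ hLip d ℓ hd hℓ amin aplus m2plus ha)) := by
  unfold ThmPrintedNNUnif
  classical
  obtain ⟨hK16, h4, HC⟩ := Classical.choose_spec (box_pair_members_noCollar F hℓ₁ hLip d ℓ hd hℓ amin aplus m2plus ha)
  set K : ℕ := KmodNC F hℓ₁ hLip d ℓ hd hℓ amin aplus m2plus ha with hKdef
  have hKeq : Classical.choose (box_pair_members_noCollar F hℓ₁ hLip d ℓ hd hℓ amin aplus m2plus ha) = K := rfl
  rw [hKeq] at hK16 h4 HC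
  have hKr : (0 : ℝ) < K := by exact_mod_cast lt_of_lt_of_le (by norm_num) hK16
  set N2 : ℝ := Real.sqrt (Fintype.card ι) with hN2
  have hN2 : 0 ≤ N2 := Real.sqrt_nonneg _
  set δ₀ : ℝ := 1 / (2 * K) with hδ₀
  have hδ₀0 : 0 < δ₀ := by positivity
  refine ⟨δ₀, 1, hδ₀0, one_pos, fun α hα0 hα1 => ?_⟩
  obtain ⟨C, hC, HC'⟩ := HC α hα0 hα1
  obtain ⟨e₁, he₁, H⟩ := HC' creg β hcreg hβ
  set c₀ : ℝ := N2 * C + 1 with hc₀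
  have hc₀0 : 0 < c₀ := by positivity
  have hNC : N2 * C ≤ c₀ := by rw [hc₀]; linarith only
  refine ⟨c₀, e₁, hc₀0, he₁, ?_⟩
  intro i hreg hbig he hle
  dsimp only [boxPairFamNC, boxPairFam] at hreg hbig he hle
  obtain ⟨hKMb, hKMs⟩ := hbig
  obtain ⟨V, Dm, Hm, dV, dD, dH⟩ := H i.k i.hk (Nat.one_le_pow i.k (ℓ + 1) (Nat.succ_pos ℓ)) i.a i.m2 i.ha1 i.ha2 i.hm1 i.hm2 i.Mb i.Ms i.o i.ho i.hMs hKMb hKMs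
    i.Ac i.e he hle hreg
  have hnr : (0 : ℝ) < (((ℓ + 1) ^ i.k : ℕ) : ℝ) := by exact_mod_cast (Nat.one_le_pow i.k (ℓ + 1) (Nat.succ_pos ℓ))
  -- the exponential conversions
  have hexp1 : ∀ {D : ℝ}, 0 ≤ D → Real.exp (-(D / K)) ≤ Real.exp (-(δ₀ * D)) := by
    intro D hD
    rw [Real.exp_le_exp, hδ₀]
    rw [show 1 / (2 * (K : ℝ)) * D = D / (2 * K) by ring]
    have : D / (2 * K) ≤ D / K := div_le_div_of_nonneg_left hD hKr (by linarith only [hKr])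
    linarith only [this]
  have hexp2 : ∀ D Db Df : ℝ, Real.exp (-((D + Db + Df) / (2 * K))) = Real.exp (-(δ₀ * D)) * Real.exp (-(δ₀ * Db + δ₀ * Df)) := by
    intro D Db Df
    rw [← Real.exp_add, hδ₀]
    congr 1
    field_simp
    ring
  -- sources: support, sup norm
  have hsrc : ∀ f : ↥(Box d ℓ i.k i.Ms) × ι → ℝ,
      (∀ p : ↥(Box d ℓ i.k i.Ms) × ι, ¬ (p.1 ∈ i.supp f) → f p = 0) ∧ 0 ≤ supN f ∧ (∀ p, |f p| ≤ supN f) :=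
    fun f => ⟨fun p hp => i.eq_zero_of_not_mem_supp f p hp, supN_nonneg f, fun p => i.abs_le_supN f p⟩
  -- distances ↦ hypotheses of the members
  have hDs : ∀ (f : ↥(Box d ℓ i.k i.Ms) × ι → ℝ) (x : ↥(Box d ℓ i.k i.Ms)) (D : ℝ), D ≤ i.sdist1 x f →
      ∀ x'', x'' ∈ i.supp f → ∃ μ, D ≤ |posR ℓ i.k i.Ms x μ - posR ℓ i.k i.Ms x'' μ| := by
    intro f x D hD x'' hx''
    refine exists_coord_of_le_supNorm ℓ i.k i.Ms x x'' ((mul_le_mul_of_nonneg_right hD hnr.le).trans ?_)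
    exact i.sdist1_mul_le x f hx''
  have hDb : ∀ (x : ↥(Box d ℓ i.k i.Ms)) (Db : ℝ), Db ≤ i.bdist1 x → ∀ y : ↥(Box d ℓ i.k i.Mb),
      ¬ inSub ℓ i.k i.Mb i.Ms i.o y → ∃ μ, Db ≤ |posR ℓ i.k i.Mb (subEmb ℓ i.k i.Mb i.Ms i.o i.ho x) μ - posR ℓ i.k i.Mb y μ| := by
    intro x Db hDb y hy
    refine exists_coord_of_le_supNorm ℓ i.k i.Mb _ y ((mul_le_mul_of_nonneg_right hDb hnr.le).trans ?_)
    exact i.bdist1_mul_le x hy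
  have hDf : ∀ (f : ↥(Box d ℓ i.k i.Ms) × ι → ℝ), ∀ x'', x'' ∈ i.supp f → ∀ y : ↥(Box d ℓ i.k i.Mb),
      ¬ inSub ℓ i.k i.Mb i.Ms i.o y →
      ∃ μ, i.bdistS f ≤ |posR ℓ i.k i.Mb (subEmb ℓ i.k i.Mb i.Ms i.o i.ho x'') μ - posR ℓ i.k i.Mb y μ| :=
    fun f x'' hx'' y hy => hDb x'' _ (i.bdistS_le f hx'') y hy
  -- vector bounds from component bounds
  have hvec : ∀ (v : ι → ℝ) {b : ℝ}, 0 ≤ b → (∀ j, |v j| ≤ C * b) → siteNorm v ≤ c₀ * b := by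
    intro v b hb hv
    refine (siteNorm_le_sqrt_card_mul v (by positivity) hv).trans ?_
    rw [← mul_assoc]
    exact mul_le_mul_of_nonneg_right hNC hb
  have hvecw : ∀ (w : ℝ) (v : ι → ℝ) {b : ℝ}, 0 ≤ w → 0 ≤ b → (∀ j, w * |v j| ≤ C * b) → w * siteNorm v ≤ c₀ * b := by
    intro w v b hw hb hv
    have : w * siteNorm v = siteNorm (w • v) := by rw [siteNorm_smul, abs_of_nonneg hw]
    rw [this]
    refine hvec (w • v) hb fun j => ?_
    rw [Pi.smul_apply, smul_eq_mul, abs_mul, abs_of_nonneg hw]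
    exact hv j
  dsimp only [Ineq19_110, Ineq111_112, boxPairFamNC, boxPairFam]
  refine ⟨⟨?_, ?_⟩, ⟨?_, ?_⟩⟩
  ---------------------------------------------------------------- (1.9) on `Ω`
  · intro μ f x x' _
    obtain ⟨hfP, hφ, hf⟩ := hsrc f
    clear V Dm dV dD dH
    show i.holderQ F α μ (i.DΩ F μ *ᵥ (i.GΩ F *ᵥ f)) x x'
      ≤ c₀ * Real.exp (-(δ₀ * min (i.sdist1 x f) (i.sdist1 x' f))) * supN f
    have hD0 : 0 ≤ min (i.sdist1 x f) (i.sdist1 x' f) := le_min (i.sdist1_nonneg x f) (i.sdist1_nonneg x' f)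
    have hb0 : 0 ≤ Real.exp (-(δ₀ * min (i.sdist1 x f) (i.sdist1 x' f))) * supN f :=
      mul_nonneg (Real.exp_pos _).le hφ
    refine i.holderQ_le F (mul_nonneg (mul_nonneg hc₀0.le (Real.exp_pos _).le) hφ) fun l hl => ?_
    obtain ⟨hx, hx', hne, hch, hend, hlen, hnear⟩ := hl
    have hw0 : 0 ≤ i.wt α x x' := Real.rpow_nonneg (div_nonneg hnr.le (supNorm_nonneg _)) α
    have := hvecw (i.wt α x x') _ hw0 hb0 fun j => by
      have h := Hm μ x x' hx hx' hne l hch hend hlen hnear (fun z => z ∈ i.supp f) _ hD0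
        (hDs f x _ (min_le_left _ _)) (hDs f x' _ (min_le_right _ _)) f hfP (supN f) hφ hf j
      calc i.wt α x x' * |(transport (fieldLink F i.κ i.AΩ) x l *ᵥ fld (i.DΩ F μ *ᵥ (i.GΩ F *ᵥ f)) x'
              - fld (i.DΩ F μ *ᵥ (i.GΩ F *ᵥ f)) x) j|
          ≤ C * Real.exp (-(min (i.sdist1 x f) (i.sdist1 x' f) / K)) * supN f := h
        _ ≤ C * (Real.exp (-(δ₀ * min (i.sdist1 x f) (i.sdist1 x' f))) * supN f) := by
            rw [mul_assoc]; exact mul_le_mul_of_nonneg_left (mul_le_mul_of_nonneg_right (hexp1 hD0) hφ) hC.le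
    calc i.wt α x x' * siteNorm (transport (fieldLink F i.κ i.AΩ) x l *ᵥ fld (i.DΩ F μ *ᵥ (i.GΩ F *ᵥ f)) x'
            - fld (i.DΩ F μ *ᵥ (i.GΩ F *ᵥ f)) x)
        ≤ c₀ * (Real.exp (-(δ₀ * min (i.sdist1 x f) (i.sdist1 x' f))) * supN f) := this
      _ = c₀ * Real.exp (-(δ₀ * min (i.sdist1 x f) (i.sdist1 x' f))) * supN f := by ring
  ---------------------------------------------------------------- (1.10) on `Ω`
  · intro μ f x _
    obtain ⟨hfP, hφ, hf⟩ := hsrc f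
    clear Hm dV dD dH
    have hD0 : 0 ≤ i.sdist1 x f := i.sdist1_nonneg x f
    have hb0 : 0 ≤ Real.exp (-(δ₀ * i.sdist1 x f)) * supN f := mul_nonneg (Real.exp_pos _).le hφ
    have hR0 : 0 ≤ c₀ * Real.exp (-(δ₀ * i.sdist1 x f)) * supN f :=
      mul_nonneg (mul_nonneg hc₀0.le (Real.exp_pos _).le) hφ
    refine ⟨?_, ?_⟩
    · show siteNorm (fld (i.DΩ F μ *ᵥ (i.GΩ F *ᵥ f)) x) ≤ c₀ * Real.exp (-(δ₀ * i.sdist1 x f)) * supN f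
      by_cases hx : x.1 + e1 μ ∈ Box d ℓ i.k i.Ms
      · have := hvec (fld (i.DΩ F μ *ᵥ (i.GΩ F *ᵥ f)) x) hb0 fun j => by
          rw [fld_apply]
          have h := Dm μ x hx (fun z => z ∈ i.supp f) _ hD0 (hDs f x _ le_rfl) f hfP (supN f) hφ hf j
          calc |(i.DΩ F μ *ᵥ (i.GΩ F *ᵥ f)) (x, j)| ≤ C * Real.exp (-(i.sdist1 x f / K)) * supN f := h
            _ ≤ C * (Real.exp (-(δ₀ * i.sdist1 x f)) * supN f) := by
                rw [mul_assoc]; exact mul_le_mul_of_nonneg_left (mul_le_mul_of_nonneg_right (hexp1 hD0) hφ) hC.le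
        calc siteNorm (fld (i.DΩ F μ *ᵥ (i.GΩ F *ᵥ f)) x) ≤ c₀ * (Real.exp (-(δ₀ * i.sdist1 x f)) * supN f) := this
          _ = c₀ * Real.exp (-(δ₀ * i.sdist1 x f)) * supN f := by ring
      · rw [i.fld_DΩ_eq_zero F μ _ x hx, siteNorm_zero]
        exact hR0
    · show siteNorm (fld (i.GΩ F *ᵥ f) x) ≤ c₀ * Real.exp (-(δ₀ * i.sdist1 x f)) * supN f
      have := hvec (fld (i.GΩ F *ᵥ f) x) hb0 fun j => by
        rw [fld_apply]
        have h := V x (fun z => z ∈ i.supp f) _ hD0 (hDs f x _ le_rfl) f hfP (supN f) hφ hf j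
        calc |(i.GΩ F *ᵥ f) (x, j)| ≤ C * Real.exp (-(i.sdist1 x f / K)) * supN f := h
          _ ≤ C * (Real.exp (-(δ₀ * i.sdist1 x f)) * supN f) := by
              rw [mul_assoc]; exact mul_le_mul_of_nonneg_left (mul_le_mul_of_nonneg_right (hexp1 hD0) hφ) hC.le
      calc siteNorm (fld (i.GΩ F *ᵥ f) x) ≤ c₀ * (Real.exp (-(δ₀ * i.sdist1 x f)) * supN f) := this
        _ = c₀ * Real.exp (-(δ₀ * i.sdist1 x f)) * supN f := by ring
  ---------------------------------------------------------------- (1.9)·(1.12) for `δG`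
  · intro μ f x x' _
    obtain ⟨hfP, hφ, hf⟩ := hsrc f
    clear V Dm Hm dV dD
    show i.holderQ F α μ (i.DΩ F μ *ᵥ i.deltaV F f) x x'
      ≤ c₀ * Real.exp (-(δ₀ * min (i.sdist1 x f) (i.sdist1 x' f)))
        * Real.exp (-(δ₀ * min (i.bdist1 x) (i.bdist1 x') + δ₀ * i.bdistS f)) * supN f
    have hD0 : 0 ≤ min (i.sdist1 x f) (i.sdist1 x' f) := le_min (i.sdist1_nonneg x f) (i.sdist1_nonneg x' f)
    have hDb0 : 0 ≤ min (i.bdist1 x) (i.bdist1 x') := le_min (i.bdist1_nonneg x) (i.bdist1_nonneg x')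
    have hDf0 : 0 ≤ i.bdistS f := i.bdistS_nonneg f
    have hb0 : 0 ≤ Real.exp (-((min (i.sdist1 x f) (i.sdist1 x' f) + min (i.bdist1 x) (i.bdist1 x') + i.bdistS f)
        / (2 * K))) * supN f := mul_nonneg (Real.exp_pos _).le hφ
    rw [show c₀ * Real.exp (-(δ₀ * min (i.sdist1 x f) (i.sdist1 x' f)))
          * Real.exp (-(δ₀ * min (i.bdist1 x) (i.bdist1 x') + δ₀ * i.bdistS f)) * supN f
        = c₀ * (Real.exp (-((min (i.sdist1 x f) (i.sdist1 x' f) + min (i.bdist1 x) (i.bdist1 x') + i.bdistS f)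
          / (2 * K))) * supN f) by rw [hexp2]; ring]
    refine i.holderQ_le F (mul_nonneg hc₀0.le hb0) fun l hl => ?_
    obtain ⟨hx, hx', hne, hch, hend, hlen, hnear⟩ := hl
    have hw0 : 0 ≤ i.wt α x x' := Real.rpow_nonneg (div_nonneg hnr.le (supNorm_nonneg _)) α
    exact hvecw (i.wt α x x') _ hw0 hb0 fun j =>
      (dH μ x x' hx hx' hne l hch hend hlen hnear (fun z => z ∈ i.supp f) _ _ _ hD0 hDb0 hDf0
        (hDs f x _ (min_le_left _ _)) (hDs f x' _ (min_le_right _ _)) (hDb x _ (min_le_left _ _))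
        (hDb x' _ (min_le_right _ _)) (hDf f) f hfP (supN f) hφ hf j).trans (le_of_eq (mul_assoc _ _ _))
  ---------------------------------------------------------------- (1.10)·(1.12) for `δG`
  · intro μ f x _
    obtain ⟨hfP, hφ, hf⟩ := hsrc f
    clear V Dm Hm dH
    have hD0 : 0 ≤ i.sdist1 x f := i.sdist1_nonneg x f
    have hDb0 : 0 ≤ i.bdist1 x := i.bdist1_nonneg x
    have hDf0 : 0 ≤ i.bdistS f := i.bdistS_nonneg f
    have hb0 : 0 ≤ Real.exp (-((i.sdist1 x f + i.bdist1 x + i.bdistS f) / (2 * K))) * supN f :=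
      mul_nonneg (Real.exp_pos _).le hφ
    have hRHS : c₀ * Real.exp (-(δ₀ * i.sdist1 x f)) * Real.exp (-(δ₀ * i.bdist1 x + δ₀ * i.bdistS f)) * supN f
        = c₀ * (Real.exp (-((i.sdist1 x f + i.bdist1 x + i.bdistS f) / (2 * K))) * supN f) := by
      rw [hexp2]; ring
    refine ⟨?_, ?_⟩
    · show siteNorm (fld (i.DΩ F μ *ᵥ i.deltaV F f) x)
        ≤ c₀ * Real.exp (-(δ₀ * i.sdist1 x f)) * Real.exp (-(δ₀ * i.bdist1 x + δ₀ * i.bdistS f)) * supN f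
      rw [hRHS]
      by_cases hx : x.1 + e1 μ ∈ Box d ℓ i.k i.Ms
      · refine hvec _ hb0 fun j => ?_
        have h := dD μ x hx (fun z => z ∈ i.supp f) _ _ _ hD0 hDb0 hDf0 (hDs f x _ le_rfl) (hDb x _ le_rfl) (hDf f)
          f hfP (supN f) hφ hf j
        rw [i.fld_DΩ_deltaV_apply F μ f x hx j]
        exact h.trans (le_of_eq (mul_assoc _ _ _))
      · rw [i.fld_DΩ_eq_zero F μ _ x hx, siteNorm_zero]
        exact mul_nonneg hc₀0.le hb0
    · show siteNorm (fld (i.deltaV F f) x)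
        ≤ c₀ * Real.exp (-(δ₀ * i.sdist1 x f)) * Real.exp (-(δ₀ * i.bdist1 x + δ₀ * i.bdistS f)) * supN f
      rw [hRHS]
      refine hvec _ hb0 fun j => ?_
      have h := dV x (fun z => z ∈ i.supp f) _ _ _ hD0 hDb0 hDf0 (hDs f x _ le_rfl) (hDb x _ le_rfl) (hDf f)
        f hfP (supN f) hφ hf j
      rw [i.fld_deltaV_apply F f x j]
      exact h.trans (le_of_eq (mul_assoc _ _ _))

/-! ## §2. The torus-parallelepiped family: dag-p3 g3's assembly in the same order -/

section Torus

variable {d : ℕ}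

/-- **THEOREM p. 573 IN THE PRINT'S QUANTIFIER ORDER ON THE FAMILY OF PROPER PARALLELEPIPEDS OF THE TORUS**
(`torusBoxFam`, `Ω ⊂ Ω₀ = T_η`, `rect := True`; moduli `Kmod`, `KmodNC`): there are `δ₀ = min(δ_T, δ_B)/2`, `R₀ = R_T`
— from the uniform torus and box pairs `(δ_T, R_T)`, `(δ_B, 1)`, before `α` — such that for every `0 ≤ α < 1` there are
`c₀ = cAll(d, c_T, c_B, δ_T, δ_B, R_T)`, `e₁ = min(e_T, e_B) > 0` with `Ineq19_110 ∧ Ineq111_112` at ALL points of every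
instance with big blocks and `0 < e ≤ e₁`.  Proof = dag-p3 g3's `thmPrintedNN_torusBoxFam` (packaging lemmas
`ineq19_110_torusBoxFam`, `ineq111_112_torusBoxFam` BY NAME) fed with the uniform quadruples.
[cite: Balaban1983RegularityDecay, Theorem (1.9)–(1.12) p.573 «depending on d, M only, c₀ on α also», «for rectangular parallelepipeds … without any restrictions»; p.572 «operators on subsets of a torus T_η»] -/
theorem thmPrintedNNUnif_torusBoxFam (F : OrthFlow ι) {ℓ₁ : ℝ} (hℓ₁ : 0 ≤ ℓ₁)
    (hLip : ∀ t (v : ι → ℝ), ((F.U t - 1) *ᵥ v) ⬝ᵥ ((F.U t - 1) *ᵥ v) ≤ (ℓ₁ * t) ^ 2 * (v ⬝ᵥ v))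
    (d ℓ : ℕ) (hd : 1 ≤ d) (hℓ : 1 ≤ ℓ) (amin aplus m2plus : ℝ) (ha : 0 < amin) (creg β : ℝ) (hcreg : 0 ≤ creg)
    (hβ : 0 < β) :
    ThmPrintedNNUnif (torusBoxFam F d ℓ amin aplus m2plus creg β (Kmod F hℓ₁ hLip d ℓ hℓ amin aplus m2plus ha)
      (KmodNC F hℓ₁ hLip d ℓ hd hℓ amin aplus m2plus ha)) := by
  have HT := thmPrintedNNUnif_torusPairFam F hℓ₁ hLip d ℓ hℓ amin aplus m2plus ha creg β hcreg hβ
  have HB := thmPrintedNNUnif_boxPairFamNC F hℓ₁ hLip d ℓ hd hℓ amin aplus m2plus ha creg β hcreg hβ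
  unfold ThmPrintedNNUnif at HT HB ⊢
  obtain ⟨δT, RT, hδT, hRT, HTα⟩ := HT
  obtain ⟨δB, RB, hδB, -, HBα⟩ := HB
  refine ⟨TorusBoxInst.dHalf δT δB, RT, TorusBoxInst.dHalf_pos hδT hδB, hRT, fun α hα0 hα1 => ?_⟩
  obtain ⟨cT, eT, hcT, heT, HTall⟩ := HTα α hα0 hα1
  obtain ⟨cB, eB', hcB, heB', HBall⟩ := HBα α hα0 hα1
  refine ⟨TorusBoxInst.cAll d cT cB δT δB RT, min eT eB',
    (TorusBoxInst.cAll_bounds (d := d) hδT hcT hδB hcB hRT).1, lt_min heT heB', ?_⟩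
  intro j hreg hbig he hle
  have HT := HTall j.toInst (j.regular_toInst F hreg) (j.bigBlocks_toInst F hbig) he (hle.trans (min_le_left _ _))
  have HF := (HTall j.full (j.regular_full F hreg) (j.bigBlocks_full F hbig) he (hle.trans (min_le_left _ _))).1
  have HB := (HBall j.boxI (j.regular_boxI F hreg) (j.bigBlocks_boxI F hbig) he (hle.trans (min_le_right _ _))).1
  exact ⟨ineq19_110_torusBoxFam j F hα0 hα1.le hδT hcT hδB hcB hRT HB,
    ineq111_112_torusBoxFam j F hα0 hα1.le hδT hcT hδB hcB hRT HT.2 HF HB⟩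

end Torus

/-! ## §3. The joins in the uniform form: one `(δ₀, R₀)` before `α` for every η-family of the tree -/

section Join

variable (F : OrthFlow ι) {ℓ₁ : ℝ} (hℓ₁ : 0 ≤ ℓ₁)
  (hLip : ∀ t (v : ι → ℝ), ((F.U t - 1) *ᵥ v) ⬝ᵥ ((F.U t - 1) *ᵥ v) ≤ (ℓ₁ * t) ^ 2 * (v ⬝ᵥ v))
  (d ℓ : ℕ) (hd : 1 ≤ d) (hℓ : 1 ≤ ℓ) (amin aplus m2plus : ℝ) (ha : 0 < amin)
  (creg β : ℝ) (hcreg : 0 ≤ creg) (hβ : 0 < β)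

include hcreg hβ in
/-- **THE LATTICE SENTENCE WITH THE PARALLELEPIPED WAIVER, UNIFORM FORM**: `ThmPrintedNNUnif` on (L) lattice big-block
pairs (`R₀` live) ⊕ (B) lattice parallelepiped pairs (no restriction). [cite: Balaban1983RegularityDecay, Theorem (1.9)–(1.12) p.573 incl. its last sentence] -/
theorem thmPrintedNNUnif_latticeJoin :
    ThmPrintedNNUnif (Sum.elim
      (regionPairFam F d ℓ amin aplus m2plus creg β (Kmod F hℓ₁ hLip d ℓ hℓ amin aplus m2plus ha))
      (boxPairFamNC F d ℓ amin aplus m2plus creg β (KmodNC F hℓ₁ hLip d ℓ hd hℓ amin aplus m2plus ha))) :=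
  thmPrintedNNUnif_sumElim _ _ (fun i => regionPairFam_signs F d ℓ amin aplus m2plus creg β _ i)
    (fun i => boxPairFamNC_signs F d ℓ amin aplus m2plus creg β _ i)
    (thmPrintedNNUnif_regionPairFam F hℓ₁ hLip d ℓ hℓ amin aplus m2plus ha creg β hcreg hβ)
    (thmPrintedNNUnif_boxPairFamNC F hℓ₁ hLip d ℓ hd hℓ amin aplus m2plus ha creg β hcreg hβ)

include hcreg hβ in
/-- **BOTH PRINTED SETTINGS, UNIFORM FORM**: `ThmPrintedNNUnif` on ((L) ⊕ (B)) ⊕ (T) torus pairs — the summands of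
dag-p3 g2's `thmPrintedNN_join3`, now with one `(δ₀, R₀)` before `α`. [cite: Balaban1983RegularityDecay, Theorem (1.9)–(1.12) p.573; p.572 (the two settings)] -/
theorem thmPrintedNNUnif_join3 :
    ThmPrintedNNUnif (Sum.elim (Sum.elim
      (regionPairFam F d ℓ amin aplus m2plus creg β (Kmod F hℓ₁ hLip d ℓ hℓ amin aplus m2plus ha))
      (boxPairFamNC F d ℓ amin aplus m2plus creg β (KmodNC F hℓ₁ hLip d ℓ hd hℓ amin aplus m2plus ha)))
      (torusPairFam F d ℓ amin aplus m2plus creg β (Kmod F hℓ₁ hLip d ℓ hℓ amin aplus m2plus ha))) := by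
  refine thmPrintedNNUnif_sumElim _ _ ?_ (fun i => torusPairFam_signs F d ℓ amin aplus m2plus creg β _ i)
    (thmPrintedNNUnif_latticeJoin F hℓ₁ hLip d ℓ hd hℓ amin aplus m2plus ha creg β hcreg hβ)
    (thmPrintedNNUnif_torusPairFam F hℓ₁ hLip d ℓ hℓ amin aplus m2plus ha creg β hcreg hβ)
  rintro (i | i)
  · exact regionPairFam_signs F d ℓ amin aplus m2plus creg β _ i
  · exact boxPairFamNC_signs F d ℓ amin aplus m2plus creg β _ i

include hcreg hβ in
/-- **THE TORUS WITH THE PARALLELEPIPED WAIVER, UNIFORM FORM**: `ThmPrintedNNUnif` on (T) torus pairs ⊕ (TB) torus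
parallelepipeds — the summands of `B4ThmTorusJoinFam.thmPrintedNN_torusJoin`, one `(δ₀, R₀)` before `α`. [cite: Balaban1983RegularityDecay, Theorem (1.9)–(1.12) p.573 incl. its last sentence; p.572 «operators on subsets of a torus T_η»] -/
theorem thmPrintedNNUnif_torusJoin :
    ThmPrintedNNUnif (Sum.elim
      (torusPairFam F d ℓ amin aplus m2plus creg β (Kmod F hℓ₁ hLip d ℓ hℓ amin aplus m2plus ha))
      (torusBoxFam F d ℓ amin aplus m2plus creg β (Kmod F hℓ₁ hLip d ℓ hℓ amin aplus m2plus ha)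
        (KmodNC F hℓ₁ hLip d ℓ hd hℓ amin aplus m2plus ha))) :=
  thmPrintedNNUnif_sumElim _ _ (fun i => torusPairFam_signs F d ℓ amin aplus m2plus creg β _ i)
    (fun j => torusBoxFam_signs F d ℓ amin aplus m2plus creg β _ _ j)
    (thmPrintedNNUnif_torusPairFam F hℓ₁ hLip d ℓ hℓ amin aplus m2plus ha creg β hcreg hβ)
    (thmPrintedNNUnif_torusBoxFam F hℓ₁ hLip d ℓ hd hℓ amin aplus m2plus ha creg β hcreg hβ)

include hcreg hβ in
/-- **EVERY (1.7)-REGULAR η-FAMILY OF THE TREE AT ONCE, UNIFORM FORM**: `ThmPrintedNNUnif` on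
(((L) ⊕ (B)) ⊕ (T)) ⊕ (TB) — one pair `(δ₀, R₀)` before `α` (the summands of `B4ThmTorusJoinFam.thmPrintedNN_join4`).
[cite: Balaban1983RegularityDecay, Theorem (1.9)–(1.12) p.573 «depending on d, M only, c₀ on α also»; p.572 (the two settings)] -/
theorem thmPrintedNNUnif_join4 :
    ThmPrintedNNUnif (Sum.elim (Sum.elim (Sum.elim
      (regionPairFam F d ℓ amin aplus m2plus creg β (Kmod F hℓ₁ hLip d ℓ hℓ amin aplus m2plus ha))
      (boxPairFamNC F d ℓ amin aplus m2plus creg β (KmodNC F hℓ₁ hLip d ℓ hd hℓ amin aplus m2plus ha)))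
      (torusPairFam F d ℓ amin aplus m2plus creg β (Kmod F hℓ₁ hLip d ℓ hℓ amin aplus m2plus ha)))
      (torusBoxFam F d ℓ amin aplus m2plus creg β (Kmod F hℓ₁ hLip d ℓ hℓ amin aplus m2plus ha)
        (KmodNC F hℓ₁ hLip d ℓ hd hℓ amin aplus m2plus ha))) := by
  refine thmPrintedNNUnif_sumElim _ _ ?_ (fun j => torusBoxFam_signs F d ℓ amin aplus m2plus creg β _ _ j)
    (thmPrintedNNUnif_join3 F hℓ₁ hLip d ℓ hd hℓ amin aplus m2plus ha creg β hcreg hβ)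
    (thmPrintedNNUnif_torusBoxFam F hℓ₁ hLip d ℓ hd hℓ amin aplus m2plus ha creg β hcreg hβ)
  rintro ((i | i) | i)
  · exact regionPairFam_signs F d ℓ amin aplus m2plus creg β _ i
  · exact boxPairFamNC_signs F d ℓ amin aplus m2plus creg β _ i
  · exact torusPairFam_signs F d ℓ amin aplus m2plus creg β _ i

end Join

end

end Literature.MathematicalPhysics.QuantumFieldTheory.Balaban1983to89.B4ThmAlphaUniformBox
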